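import Summits.QuantumFields.YangMills.Theorems.BalabanUVNodesN21ThresholdMixture
import Literature.MathematicalPhysics.QuantumFieldTheory.Balaban1983to89.B14Eq216Concrete
import Literature.MathematicalPhysics.QuantumFieldTheory.Balaban1983to89.MissingProofs

/-!
# YM-DAG node N21 (= NE7c) — THE MIXTURE ROAD'S CURRENCY AT PRINT's (2.17) LETTER (file 13a): the small-field function `χ({sup_{p⊂□^∼}|U(∂p) − 1| < δ})`
# IS `T4IndicatorShell.smallInd` of the THRESHOLD-FREE block-sup, r11's (2.17) `chi217` is the DIAGONAL of a per-cube-threshold sharp slot product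
# (the threshold vector an explicit argument — no new definition), and the COMMON-BOX threshold average of such a product IS design (η)'s profiled product

Track A of `YM-PLAN.md` (cell `pub-ymgap`, HUMAN RULING D-0062), node **N21** (NE7c, `T4IndicatorShell.ShellWeightBound`, NOT PRINTED);
R141 (C) fan-out seat `pub-ymgap-dag-n21-e` (strategy s3 = ALTERNATIVE CURRENCY), generation 4, file 13a of the lineage (files 5a–12′:
the THRESHOLD-MIXTURE road, p466893 … p486587; file 13b `BalabanUVNodesN21ThresholdMixtureRecordChiAtRecord` reads this one AT def-R's
`Node00.chiOfRecord`).  THEOREMS ONLY: 0 `def`, 0 `sorry`, standard axioms; COUNT-NEUTRAL; `--supports` the K3′ item `SpineGivenEndpointR12`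
(stmt-QuantumFields-19908) as a helper.  NO Theses import (restate-immune).  Imports file 5a `BalabanUVNodesN21ThresholdMixture` (p466893: the lens
lemmas `linProfile_eq_thresholdAverage`, `integral_fac_smallInd`), r11's `B14Eq216Concrete` (`B14.Eq216Concrete.chi217 ∕ ukBox`, [Balaban1988Convergent]
(2.16)–(2.17) p. 257 WITH BODY) and `MissingProofs` (`Missing.measurable_plaqHol`; `RegularGaugeGroup` of `UnitaryModel`); `Setup`'s `chiSmall ∕ PlaqSmallOn ∕
dist1 ∕ plaqHol`.  Restates nothing; cites by name.  [III] = [Balaban1988Convergent], [IV] = [Balaban1989LargeFieldI].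

WHY THIS MODULE (the g4 trigger census, 2026-08-27).  The mixture road's K5 readings of N21 (`…N21AtSpineCarriersMixtureCommonBox.s_N21_of_sharpCommonBoxReading`,
p479591; two-threshold twin p483387) display, per run, (O-mix-1) a THRESHOLD-FREE SHARP REPRESENTATION of every term — `Xs K t τ s = ∫ (∏_i fac_i(smallInd (u_i v) (s i)))
· R v ∂μ` for EVERY threshold vector `s`, with the carriers the normalised averages of `Xs` over the box `⊗_i Leb|[(1 − κ_{a_i})θ_i, θ_i]` — and (O-mix-3′)
an OCCURRENCE STRUCTURE — per step a finite list of occurrences of background-mediated characteristic functions with nominal thresholds, each term reading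
its own factors through an injective coordinate map `e K τ`.  Both were LOCATED inputs «NODE O's term object at the ₁₂ record».  For the one
background-mediated characteristic function the tree has typed WITH BODY — the generation-`k` small-field function (2.17) [III] p. 257,
`χ_k(Ω_k) = ∏_{□ ⊂ Ω_k} χ({sup_{p ⊂ □^∼}|U_{k,□}(V_k, ∂p) − 1| < ε_kη²})` (r11's `chi217`; def-R's `Node00.chiOfRecord` v2 p487299 and FILE 4's term-indexed
`Node00.chiSeqOfRecord` pin its arguments) — BOTH inputs are theorems about the existing letters once the per-cube threshold is an explicit vector
`S : □ ↦ ℝ` (no `chiOfRecordCube` definition is needed; lens ROW T-1 stays optional).  This file is the CURRENCY (any gauge group, any [15] datum `bg`):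
* (O-mix-1) each factor is `χ({…}) = smallInd (u_□(V)) (ε_kη²)` with the THRESHOLD-FREE tested variable `u_□(V) = sup_{p ⊂ □^∼} |U_{k,□}(V)(∂p) − 1|` (the
  block-sup of `dist1 ∘ plaqHol ∘ ukBox`, which reads the (2.12) datum, `M₁` and the cube geometry but NO threshold — the lens seat's (K-ii) PASS,
  `LENS-nearmiss.md` v3.0 census u, here a kernel sentence), measurable for a measurably normed group;
* (O-mix-3′) a term reads a sub-family `A` of the step's occurrences `ι`; its coordinate map into `ι` is injective (`prod_smallInd_reindex_fin` gives the
  `Fin #A`-letter of files 10a∕10b);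
* THE MIXTURE IDENTITY: averaging the per-occurrence-threshold SHARP product `∏_{c ∈ A} smallInd (u_c) (S c)` over the COMMON BOX `⊗_{c : ι} Leb|[(1 − κ_c)θ_c, θ_c]`
  of ONE multiplier per occurrence (ALL occurrences of the step, the unread ones cancelling) gives EXACTLY design (η)'s profiled product
  `∏_{c ∈ A} linProfile κ_c (u_c ∕ θ_c)` (`T4LipschitzCutoff.linProfile`) — pointwise, and, against ANY integrable remainder density under ANY s-finite field
  law, as the `hXs`∕`hA` PAIR of the K5 reading: «carrier = normalised common-box average of a threshold-free sharp weight».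
What remains displayed for NODE O is the SAME typing for the OTHER occurrences — the 𝐓-operation's (3.3)∕(3.16) functions and the 𝐑-operation's (1.22) [IV]
functions (def-T's `TkWeightsOfRecord` ∕ `RStepSlotOfRecord`; lens ROW T-2 display rule, trigger text (t-n′)) — and the remainder's integrability.

WHAT IS PROVED ([folklore] bookkeeping; nothing of Bałaban's asserted).
* §1 (`Setup` level, any gauge group) THE BLOCK-SUP TESTED VARIABLE `⨆_{p ∈ S} dist1 (U(∂p))` (written inline): nonnegativity, domination of each
  plaquette variable, `< δ ↔ PlaqSmallOn` (for `S ≠ ∅` or `δ > 0`), ★ `chiSmall_eq_smallInd_iSup` (print's χ IS `T4IndicatorShell.smallInd` of the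
  block-sup; the `Finset.sup'` form is the lens seat's `chiSmall_eq_smallInd`, `Sketch-nearmiss-g3.lean` §D — credited), `chiSmall_eq_fac_small` (the
  `hXs` letter `Pol.small.fac (smallInd …)`), the BANDS of dag-n21-d's `N21SlotTestAtRecord` §1 as pv07's single-run shell indicators
  (`chiSmall_sub_chiSmall_eq_shellBelow ∕ _eq_shellAbove`), Δ-closeness of block-sups from per-plaquette Δ-closeness (`abs_iSup_dist1_sub_le`, N16's
  in-edge at the tested variable) and hence `T4IndicatorShell.smallInd_mul_one_sub_le` at the block-sups (`chiSmall_mul_one_sub_le_shellBelow_iSup` =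
  dag-n21-d's `chiSmall_mul_one_sub_chiSmall_le_band` with the band named), and MEASURABILITY of the block-sup (`measurable_iSup_dist1`, `[RegularGaugeGroup G]`).
* §2 (r11's (2.17), generic [15] datum `bg`) ★ `chi217_eq_prod_smallInd` — (2.17) is the per-cube-threshold sharp slot product ON THE DIAGONAL; and the
  generic real-analysis identities of the common box: ★ `commonBox_average_prod_smallInd_eq` (`(∏_c κ_cθ_c)⁻¹ ∫ ∏_{c ∈ A} smallInd (u_c) (S c) ∂(⊗_c Leb|[(1−κ_c)θ_c,
  θ_c]) = ∏_{c ∈ A} linProfile κ_c (u_c∕θ_c)` over the FULL box of all occurrences `c : ι`), `measurable_prod_smallInd_eval`, `prod_smallInd_mem_unitInterval`,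
  `integrable_commonBox_integrand`, ★ `commonBox_average_weight_eq` (the same inside a field integral against an integrable remainder — one Fubini swap;
  files 5b∕10a's `mixture_repr` ∕ `average_comp_proj_pi` over a general finite occurrence type), `prod_smallInd_reindex_fin`.

HONEST FRAMING.  COUNT-NEUTRAL; N21 NOT discharged; NE7c NOT PRINTED ∕ NOT proved.  This types (O-mix-1)∕(O-mix-3′) for the generation-`k` factor `χ_k(Ω_k)` ONLY;
the mixture is a convex combination of print's SHARP procedure over admissible threshold vectors — NOT print verbatim; (M1) for print's deterministic sharp
procedure is untouched; the single-run inputs (N16 `SupClose`, N20's sharp class-relative bounds on the common box), the width `ρ`, the record weight `Wsh` and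
NODE O's typing of the other occurrences stay displayed exactly as in files 10b ∕ 11b ∕ 12.  One finite `T⁴` programme at fixed `ε`, Bałaban as printed;
nothing continuum ∕ ℝ⁴ ∕ OS ∕ mass-gap ∕ Clay.
-/


noncomputable section

open MeasureTheory Set
open scoped BigOperators ENNReal

namespace Summit.QuantumFields.YangMills.Theorems.N21ThresholdMixtureRecordChi

open Literature.MathematicalPhysics.QuantumFieldTheory.Balaban1983to89
open Literature.MathematicalPhysics.QuantumFieldTheory.Balaban1983to89.T4IndicatorShell
open Literature.MathematicalPhysics.QuantumFieldTheory.Balaban1983to89.T4LipschitzCutoff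
open Literature.MathematicalPhysics.QuantumFieldTheory.Balaban1983to89.T4LipschitzLedger
open Summit.QuantumFields.YangMills.Theorems.N21ThresholdMixture

/-! ## §1 The block-sup tested variable of a cube slot (`Setup` level) -/

section BlockSup

variable {P : Params} {j : ℕ} {G : Type*} [GaugeGroup G]

/-- The block-sup `sup_{p ∈ S} |U(∂p) − 1|` is nonnegative (empty sup `= 0` included). [folklore] -/
theorem iSup_dist1_nonneg (S : Set (Plaq P j)) (U : GaugeField P j G) :
    0 ≤ ⨆ p : S, dist1 (GaugeField.plaqHol U p.1) :=
  Real.iSup_nonneg fun _ => GaugeGroup.dist1_nonneg _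

/-- Every plaquette variable of the block is dominated by the block-sup. [folklore] -/
theorem dist1_le_iSup_dist1 {S : Set (Plaq P j)} (U : GaugeField P j G) {p : Plaq P j} (hp : p ∈ S) :
    dist1 (GaugeField.plaqHol U p) ≤ ⨆ q : S, dist1 (GaugeField.plaqHol U q.1) :=
  le_ciSup (Finite.bddAbove_range fun q : S => dist1 (GaugeField.plaqHol U q.1)) (⟨p, hp⟩ : S)

/-- The block-sup is below `δ` iff every plaquette variable of the block is (`S ≠ ∅` or `δ > 0`; for `S = ∅` and `δ ≤ 0` the left side
fails while `PlaqSmallOn ∅` holds vacuously). [folklore] -/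
theorem iSup_dist1_lt_iff {S : Set (Plaq P j)} {δ : ℝ} (h : S.Nonempty ∨ 0 < δ) (U : GaugeField P j G) :
    (⨆ p : S, dist1 (GaugeField.plaqHol U p.1)) < δ ↔ PlaqSmallOn S δ U := by
  constructor
  · intro hlt p hp
    exact (dist1_le_iSup_dist1 U hp).trans_lt hlt
  · intro hall
    rcases S.eq_empty_or_nonempty with hS | hS
    · subst hS
      rcases h with h | h
      · exact absurd h Set.not_nonempty_empty
      · haveI : IsEmpty (↥(∅ : Set (Plaq P j))) := by simp
        rw [Real.iSup_of_isEmpty]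
        exact h
    · haveI : Nonempty S := hS.to_subtype
      obtain ⟨q, hq⟩ := exists_eq_ciSup_of_finite (f := fun q : S => dist1 (GaugeField.plaqHol U q.1))
      rw [← hq]
      exact hall q.1 q.2

/-- ★ **PRINT'S χ IS THE ABSTRACT `smallInd` OF THE BLOCK-SUP.**  For a plaquette set `S` and a threshold `δ` with `S ≠ ∅` or `δ > 0`:
`χ({|U(∂p) − 1| < δ, p ∈ S}) = 1[sup_{p ∈ S}|U(∂p) − 1| < δ]`, i.e. `Setup.chiSmall S δ U = T4IndicatorShell.smallInd (⨆_{p∈S} dist1 (U(∂p))) δ` — the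
tested variable of the shell files IS the block-sup of (2.17).  (The `Finset.sup'` form is the lens seat's `chiSmall_eq_smallInd`,
`ym-lens-BalabanUVNodes-nearmiss/Sketch-nearmiss-g3.lean` §D, memo-only; credited.) [cite: Balaban1988Convergent, (2.17) p.257] -/
theorem chiSmall_eq_smallInd_iSup {S : Set (Plaq P j)} {δ : ℝ} (h : S.Nonempty ∨ 0 < δ) (U : GaugeField P j G) :
    chiSmall S δ U = smallInd (⨆ p : S, dist1 (GaugeField.plaqHol U p.1)) δ := by
  unfold chiSmall smallInd
  by_cases hs : PlaqSmallOn S δ U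
  · rw [if_pos hs, if_pos ((iSup_dist1_lt_iff h U).2 hs)]
  · rw [if_neg hs, if_neg fun h' => hs ((iSup_dist1_lt_iff h U).1 h')]

/-- The same in the letter of the K5 readings' `hXs` clause: a small-field slot factor is `Pol.small.fac (smallInd u s)`. [folklore] -/
theorem chiSmall_eq_fac_small {S : Set (Plaq P j)} {δ : ℝ} (h : S.Nonempty ∨ 0 < δ) (U : GaugeField P j G) :
    chiSmall S δ U = Pol.small.fac (smallInd (⨆ p : S, dist1 (GaugeField.plaqHol U p.1)) δ) := by
  rw [Pol.fac_small, chiSmall_eq_smallInd_iSup h U]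

/-- THE LOWER BAND IS pv07's SHELL BELOW.  For `0 ≤ Δ` (and `S ≠ ∅` or `δ − Δ > 0`): `χ_δ(U) − χ_{δ−Δ}(U) = 1[δ − Δ ≤ u < δ]` at the block-sup `u` —
dag-n21-d's record-currency band (`N21SlotTestAtRecord.chiSmall_band_nonneg` ff.) IS `T4IndicatorShell.shellBelow`. [folklore] -/
theorem chiSmall_sub_chiSmall_eq_shellBelow {S : Set (Plaq P j)} {δ Δ : ℝ} (hΔ : 0 ≤ Δ) (h : S.Nonempty ∨ 0 < δ - Δ)
    (U : GaugeField P j G) :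
    chiSmall S δ U - chiSmall S (δ - Δ) U =
      shellBelow (⨆ p : S, dist1 (GaugeField.plaqHol U p.1)) δ Δ := by
  have h' : S.Nonempty ∨ 0 < δ := h.imp_right fun h0 => by linarith
  rw [chiSmall_eq_smallInd_iSup h' U, chiSmall_eq_smallInd_iSup h U]
  unfold smallInd shellBelow
  by_cases h1 : (⨆ p : S, dist1 (GaugeField.plaqHol U p.1)) < δ - Δ
  · have h2 : (⨆ p : S, dist1 (GaugeField.plaqHol U p.1)) < δ := by linarith
    rw [if_pos h2, if_pos h1, if_neg (fun hh => (not_le.2 h1) hh.1)]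
    ring
  · by_cases h2 : (⨆ p : S, dist1 (GaugeField.plaqHol U p.1)) < δ
    · rw [if_pos h2, if_neg h1, if_pos ⟨not_lt.1 h1, h2⟩]
      ring
    · rw [if_neg h2, if_neg h1, if_neg (fun hh => h2 hh.2)]
      ring

/-- THE UPPER BAND IS pv07's SHELL ABOVE.  For `0 ≤ Δ` (and `S ≠ ∅` or `δ > 0`): `χ_{δ+Δ}(U) − χ_δ(U) = 1[δ ≤ u < δ + Δ]` at the block-sup `u`. [folklore] -/
theorem chiSmall_sub_chiSmall_eq_shellAbove {S : Set (Plaq P j)} {δ Δ : ℝ} (hΔ : 0 ≤ Δ) (h : S.Nonempty ∨ 0 < δ)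
    (U : GaugeField P j G) :
    chiSmall S (δ + Δ) U - chiSmall S δ U =
      shellAbove (⨆ p : S, dist1 (GaugeField.plaqHol U p.1)) δ Δ := by
  have h' : S.Nonempty ∨ 0 < δ + Δ := h.imp_right fun h0 => by linarith
  rw [chiSmall_eq_smallInd_iSup h' U, chiSmall_eq_smallInd_iSup h U]
  unfold smallInd shellAbove
  by_cases h1 : (⨆ p : S, dist1 (GaugeField.plaqHol U p.1)) < δ
  · have h2 : (⨆ p : S, dist1 (GaugeField.plaqHol U p.1)) < δ + Δ := by linarith
    rw [if_pos h2, if_pos h1, if_neg (fun hh => (not_le.2 h1) hh.1)]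
    ring
  · by_cases h2 : (⨆ p : S, dist1 (GaugeField.plaqHol U p.1)) < δ + Δ
    · rw [if_pos h2, if_neg h1, if_pos ⟨not_lt.1 h1, h2⟩]
      ring
    · rw [if_neg h2, if_neg h1, if_neg (fun hh => h2 hh.2)]
      ring

/-- **N16's IN-EDGE AT THE TESTED VARIABLE.**  If two configurations' plaquette variables on `S` are `Δ`-close plaquette by plaquette (`Δ ≥ 0`), their
block-sups are `Δ`-close. [folklore] -/
theorem abs_iSup_dist1_sub_le {S : Set (Plaq P j)} {Δ : ℝ} (hΔ : 0 ≤ Δ) {U U' : GaugeField P j G}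
    (hclose : ∀ p ∈ S, |dist1 (GaugeField.plaqHol U p) - dist1 (GaugeField.plaqHol U' p)| ≤ Δ) :
    |(⨆ p : S, dist1 (GaugeField.plaqHol U p.1)) - ⨆ p : S, dist1 (GaugeField.plaqHol U' p.1)| ≤ Δ := by
  rw [abs_sub_le_iff]
  constructor
  · rw [sub_le_iff_le_add]
    refine Real.iSup_le (fun q => ?_) (by linarith [iSup_dist1_nonneg S U'])
    have h1 := (abs_sub_le_iff.1 (hclose q.1 q.2)).1
    linarith [dist1_le_iSup_dist1 U' q.2]
  · rw [sub_le_iff_le_add]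
    refine Real.iSup_le (fun q => ?_) (by linarith [iSup_dist1_nonneg S U])
    have h1 := (abs_sub_le_iff.1 (hclose q.1 q.2)).2
    linarith [dist1_le_iSup_dist1 U q.2]

/-- Hence pv07's SHELL DOMINATION at the block-sups: the mismatch «small for `U`, not small for `U′`» at a common threshold lies in `U`'s own shell
below the threshold — `T4IndicatorShell.smallInd_mul_one_sub_le` BY NAME; through §1 this is dag-n21-d's `N21SlotTestAtRecord.chiSmall_mul_one_sub_chiSmall_le_band`
(the two N21 slot currencies bridged). [folklore] -/
theorem chiSmall_mul_one_sub_le_shellBelow_iSup {S : Set (Plaq P j)} {δ Δ : ℝ} (hΔ : 0 ≤ Δ) (h : S.Nonempty ∨ 0 < δ)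
    {U U' : GaugeField P j G}
    (hclose : ∀ p ∈ S, |dist1 (GaugeField.plaqHol U p) - dist1 (GaugeField.plaqHol U' p)| ≤ Δ) :
    chiSmall S δ U * (1 - chiSmall S δ U') ≤ shellBelow (⨆ p : S, dist1 (GaugeField.plaqHol U p.1)) δ Δ := by
  rw [chiSmall_eq_smallInd_iSup h U, chiSmall_eq_smallInd_iSup h U']
  exact smallInd_mul_one_sub_le (abs_iSup_dist1_sub_le hΔ hclose)

/-- **MEASURABILITY OF THE BLOCK-SUP** in the configuration, for a measurably normed gauge group (`RegularGaugeGroup`: `dist1` measurable): a finite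
supremum of the measurable `U ↦ dist1 (U(∂p))`. [folklore] -/
theorem measurable_iSup_dist1 [MeasurableSpace G] [RegularGaugeGroup G] (S : Set (Plaq P j)) :
    Measurable fun U : GaugeField P j G => ⨆ p : S, dist1 (GaugeField.plaqHol U p.1) :=
  Measurable.iSup fun p => RegularGaugeGroup.measurable_dist1.comp (Missing.measurable_plaqHol p.1)

end BlockSup

/-! ## §2 (2.17) as the diagonal of the per-cube-threshold sharp slot product; the common-box identities -/

section Chi217

open B15DeterminingSets B14.Eq216Concrete

variable {P : Params} {G : Type*} [GaugeGroup G] {av : ∀ j, Averaging P j G}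
  (bg : DetBackground P G av) (M₁ : ℕ) {ι : Type*}

/-- ★ **(2.17) IS THE DIAGONAL OF THE PER-CUBE-THRESHOLD SHARP SLOT PRODUCT.**  For a positive level threshold `ε_kη² > 0`:
`χ_k(Ω_k)(V) = ∏_{□ ∈ X} smallInd (u_□(V)) (ε_kη²)` with the threshold-free tested variables `u_□(V) = sup_{p ∈ plaqT □} |U_{k,□}(V)(∂p) − 1|`
(`U_{k,□} = ukBox bg M₁ (enl4 □) k`).  Replacing the constant `ε_kη²` by a vector `S □` gives the sharp family the mixture road averages; this is its
value at `S ≡ ε_kη²`. [cite: Balaban1988Convergent, (2.17) p.257] -/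
theorem chi217_eq_prod_smallInd (X : Finset ι) (plaqT : ι → Set (Plaq P 0)) (enl4 : ι → Set (Site P 0)) {εk : ℝ} (k : ℕ)
    (hε : 0 < εk * P.eta k ^ 2) (Vk : GaugeField P k G) :
    chi217 bg M₁ X plaqT enl4 εk k Vk =
      ∏ c ∈ X, smallInd (⨆ p : plaqT c, dist1 (GaugeField.plaqHol (ukBox bg M₁ (enl4 c) k Vk) p.1)) (εk * P.eta k ^ 2) := by
  rw [chi217_apply]
  exact Finset.prod_congr rfl fun c _ => chiSmall_eq_smallInd_iSup (Or.inr hε) _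

end Chi217

section CommonBox

variable {ι : Type*} [Fintype ι] [DecidableEq ι]

/-- one window integral of the sharp indicator: `∫_{[(1−κ)θ, θ]} 1[u < s] ds = κθ · linProfile κ (u∕θ)` (file 5a's `integral_fac_smallInd` at polarity
`small`). [folklore] -/
theorem integral_smallInd_window {κ θ : ℝ} (hκ : 0 < κ) (hθ : 0 < θ) (u : ℝ) :
    ∫ s in Icc ((1 - κ) * θ) θ, smallInd u s = κ * θ * linProfile κ (u / θ) := by
  simpa only [Pol.fac_small] using integral_fac_smallInd Pol.small hκ hθ u

/-- the window has Lebesgue mass `κθ`. [folklore] -/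
theorem integral_one_window {κ θ : ℝ} (hκ : 0 < κ) (hθ : 0 < θ) :
    ∫ _s in Icc ((1 - κ) * θ) θ, (1 : ℝ) = κ * θ := by
  rw [setIntegral_const, smul_eq_mul, mul_one, measureReal_def, Real.volume_Icc,
    ENNReal.toReal_ofReal (by nlinarith [mul_pos hκ hθ])]
  ring

/-- ★ **THE COMMON-BOX AVERAGE OF A TERM'S SHARP χ-PRODUCT IS ITS (η)-PROFILED χ-PRODUCT.**  Occurrences `c : ι` (ALL cubes of the step), one threshold
coordinate per occurrence with window `[(1 − κ_c)θ_c, θ_c]` (`0 < κ_c`, `0 < θ_c`); a term reading the sub-family `A` of occurrences with tested values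
`u_c`.  Then `(∏_c κ_cθ_c)⁻¹ · ∫ ∏_{c ∈ A} 1[u_c < S_c] d(⊗_c Leb|window_c)(S) = ∏_{c ∈ A} linProfile κ_c (u_c∕θ_c)` — the unread coordinates contribute their
masses `κ_cθ_c` and cancel (files 5a∕10a: `sharpMixture_prod_eq_profile_prod` ∕ `average_comp_proj_pi`, here over a general finite occurrence type by
`MeasureTheory.integral_fintype_prod_eq_prod`). [folklore] -/
theorem commonBox_average_prod_smallInd_eq (A : Finset ι) (κ θ u : ι → ℝ) (hκ : ∀ c, 0 < κ c) (hθ : ∀ c, 0 < θ c) :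
    (∏ c, (κ c * θ c))⁻¹ *
        ∫ S, ∏ c ∈ A, smallInd (u c) (S c) ∂(Measure.pi fun c => volume.restrict (Icc ((1 - κ c) * θ c) (θ c)))
      = ∏ c ∈ A, linProfile (κ c) (u c / θ c) := by
  have hprod : ∀ S : ι → ℝ, ∏ c ∈ A, smallInd (u c) (S c) = ∏ c, (if c ∈ A then smallInd (u c) (S c) else 1) := by
    intro S
    rw [Finset.prod_ite_mem, Finset.univ_inter]
  simp_rw [hprod]
  rw [MeasureTheory.integral_fintype_prod_eq_prod (𝕜 := ℝ) (E := fun _ => ℝ)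
    (fun c s => if c ∈ A then smallInd (u c) s else 1)]
  have hfac : ∀ c, (∫ s in Icc ((1 - κ c) * θ c) (θ c), (if c ∈ A then smallInd (u c) s else 1)) =
      κ c * θ c * (if c ∈ A then linProfile (κ c) (u c / θ c) else 1) := by
    intro c
    by_cases hc : c ∈ A
    · simp only [hc, if_true]
      exact integral_smallInd_window (hκ c) (hθ c) (u c)
    · simp only [hc, if_false, mul_one]
      exact integral_one_window (hκ c) (hθ c)
  simp_rw [hfac]
  have hsplit : (∏ c, (κ c * θ c * (if c ∈ A then linProfile (κ c) (u c / θ c) else 1))) =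
      (∏ c, (κ c * θ c)) * ∏ c, (if c ∈ A then linProfile (κ c) (u c / θ c) else 1) := Finset.prod_mul_distrib
  rw [hsplit, ← mul_assoc,
    inv_mul_cancel₀ (Finset.prod_ne_zero_iff.2 fun c _ => (mul_pos (hκ c) (hθ c)).ne'), one_mul,
    Finset.prod_ite_mem, Finset.univ_inter]

variable {Y : Type*} [MeasurableSpace Y]

omit [Fintype ι] [DecidableEq ι] in
/-- the sharp χ-product of a term is jointly measurable in (threshold vector, field) for measurable tested variables. [folklore] -/
theorem measurable_prod_smallInd_eval (A : Finset ι) {u : ι → Y → ℝ} (hu : ∀ c ∈ A, Measurable (u c)) :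
    Measurable fun p : (ι → ℝ) × Y => ∏ c ∈ A, smallInd (u c p.2) (p.1 c) := by
  refine Finset.measurable_prod _ fun c hc => ?_
  unfold smallInd
  refine Measurable.ite ?_ measurable_const measurable_const
  exact measurableSet_lt ((hu c hc).comp measurable_snd) ((measurable_pi_apply c).comp measurable_fst)

omit [Fintype ι] [DecidableEq ι] in
/-- a product of sharp indicators lies in `[0, 1]`. [folklore] -/
theorem prod_smallInd_mem_unitInterval (A : Finset ι) (u S : ι → ℝ) :
    0 ≤ ∏ c ∈ A, smallInd (u c) (S c) ∧ ∏ c ∈ A, smallInd (u c) (S c) ≤ 1 :=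
  ⟨Finset.prod_nonneg fun _ _ => smallInd_nonneg _ _,
    Finset.prod_le_one (fun _ _ => smallInd_nonneg _ _) fun _ _ => smallInd_le_one _ _⟩

omit [DecidableEq ι] in
/-- **JOINT INTEGRABILITY** of `(S, v) ↦ (∏_{c ∈ A} 1[u_c v < S_c]) · R v` on (common box) × (field space): the product is measurable with values in `[0, 1]`,
`R` is integrable and the box is finite. [folklore] -/
theorem integrable_commonBox_integrand (μ : Measure Y) [SFinite μ] (A : Finset ι) {u : ι → Y → ℝ}
    (hu : ∀ c ∈ A, Measurable (u c)) {R : Y → ℝ} (hR : Integrable R μ) (lo hi : ι → ℝ) :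
    Integrable (Function.uncurry fun (S : ι → ℝ) (v : Y) => (∏ c ∈ A, smallInd (u c v) (S c)) * R v)
      ((Measure.pi fun c : ι => volume.restrict (Icc (lo c) (hi c))).prod μ) := by
  have hR2 : Integrable (fun p : (ι → ℝ) × Y => R p.2)
      ((Measure.pi fun c : ι => volume.restrict (Icc (lo c) (hi c))).prod μ) :=
    hR.comp_snd (Measure.pi fun c : ι => volume.restrict (Icc (lo c) (hi c)))
  refine hR2.norm.mono' ((measurable_prod_smallInd_eval A hu).aestronglyMeasurable.mul hR2.aestronglyMeasurable)
    (ae_of_all _ fun p => ?_)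
  obtain ⟨S, v⟩ := p
  have h01 := prod_smallInd_mem_unitInterval A (fun c => u c v) S
  show ‖(∏ c ∈ A, smallInd (u c v) (S c)) * R v‖ ≤ ‖R v‖
  rw [norm_mul, Real.norm_of_nonneg h01.1]
  exact mul_le_of_le_one_left (norm_nonneg _) h01.2

/-- ★ **THE `hXs`∕`hA` PAIR: the normalised common-box average of a threshold-free SHARP WEIGHT is the PROFILED WEIGHT.**  For measurable tested variables `u_c`
(`c ∈ A`), an integrable remainder `R` under an s-finite field law `μ`, windows with `0 < κ_c`, `0 < θ_c`:
`(∏_c κ_cθ_c)⁻¹ ∫ (∫ (∏_{c ∈ A} 1[u_c v < S_c]) R v ∂μ) d(⊗_c Leb|window_c)(S) = ∫ (∏_{c ∈ A} linProfile κ_c (u_c v∕θ_c)) R v ∂μ` (one Fubini swap; files 5b∕10a's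
`mixture_repr` ∕ `average_comp_proj_pi` over a general finite occurrence type). [folklore] -/
theorem commonBox_average_weight_eq (μ : Measure Y) [SFinite μ] (A : Finset ι) (κ θ : ι → ℝ) {u : ι → Y → ℝ}
    (hu : ∀ c ∈ A, Measurable (u c)) {R : Y → ℝ} (hR : Integrable R μ) (hκ : ∀ c, 0 < κ c) (hθ : ∀ c, 0 < θ c) :
    (∏ c, (κ c * θ c))⁻¹ *
        ∫ S, (∫ v, (∏ c ∈ A, smallInd (u c v) (S c)) * R v ∂μ)
          ∂(Measure.pi fun c => volume.restrict (Icc ((1 - κ c) * θ c) (θ c)))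
      = ∫ v, (∏ c ∈ A, linProfile (κ c) (u c v / θ c)) * R v ∂μ := by
  set C : ℝ := ∏ c, (κ c * θ c) with hC
  have hCpos : 0 < C := Finset.prod_pos fun c _ => mul_pos (hκ c) (hθ c)
  have hswap := integral_integral_swap
    (integrable_commonBox_integrand μ A hu hR (fun c => (1 - κ c) * θ c) (fun c => θ c))
  rw [hswap]
  have hinner : (fun v => ∫ S, (∏ c ∈ A, smallInd (u c v) (S c)) * R v
      ∂(Measure.pi fun c => volume.restrict (Icc ((1 - κ c) * θ c) (θ c)))) =
      fun v => C * ((∏ c ∈ A, linProfile (κ c) (u c v / θ c)) * R v) := by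
    funext v
    have hav := commonBox_average_prod_smallInd_eq A κ θ (fun c => u c v) hκ hθ
    rw [← hC] at hav
    have hI : ∫ S, ∏ c ∈ A, smallInd (u c v) (S c) ∂(Measure.pi fun c => volume.restrict (Icc ((1 - κ c) * θ c) (θ c))) =
        C * ∏ c ∈ A, linProfile (κ c) (u c v / θ c) := by
      rw [← hav, ← mul_assoc, mul_inv_cancel₀ hCpos.ne', one_mul]
    rw [integral_mul_const, hI]
    ring
  rw [hinner, integral_const_mul, ← mul_assoc, inv_mul_cancel₀ hCpos.ne', one_mul]

omit [Fintype ι] [DecidableEq ι] in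
/-- **(O-mix-3′) IN THE `Fin m`-LETTER OF FILES 10a∕10b.**  A term's cube set `A` is read through the coordinate map `e : Fin #A → ι`,
`e i = (A.equivFin.symm i).1`, which is INJECTIVE, lands in `A`, and re-indexes the sharp product: `∏_{c ∈ A} 1[u_c < S_c] = ∏_{i : Fin #A} 1[u_{e i} < S_{e i}]`
— the `e K τ` ∕ `S ∘ e` letters of `…N21ThresholdMixtureCommonBox.siblingSuppression_of_sharpCommonBox`. [folklore] -/
theorem prod_smallInd_reindex_fin (A : Finset ι) (u S : ι → ℝ) :
    Function.Injective (fun i : Fin A.card => ((A.equivFin.symm i).1 : ι)) ∧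
      (∀ i : Fin A.card, ((A.equivFin.symm i).1 : ι) ∈ A) ∧
      ∏ c ∈ A, smallInd (u c) (S c) = ∏ i : Fin A.card, smallInd (u (A.equivFin.symm i).1) (S (A.equivFin.symm i).1) := by
  refine ⟨fun i i' h => A.equivFin.symm.injective (Subtype.ext h), fun i => (A.equivFin.symm i).2, ?_⟩
  rw [← Finset.prod_coe_sort A]
  exact (Fintype.prod_equiv A.equivFin.symm (fun i => smallInd (u (A.equivFin.symm i).1) (S (A.equivFin.symm i).1))
    (fun c => smallInd (u c.1) (S c.1)) fun _ => rfl).symm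

end CommonBox

end Summit.QuantumFields.YangMills.Theorems.N21ThresholdMixtureRecordChi

end
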